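import Mathlib
import HarnessLib
import HarnessLib.Audit
import Summits.HubbardSuperconductivity.Statement
import Literature.MathematicalPhysics.QuantumLattice.DWaveSource
import Literature.MathematicalPhysics.QuantumLattice.DWaveOnePointCertificate
import HarnessLib.Audit.Status.Attr

/-!
Route: AbsenceCertificate

DORMANT since 2026-08-22T09:16:08Z (reconciler: no traction for 5.2 d (last activity item-evidence-added at 2026-08-17T03:03:09Z); parked, not closed — `ledger route dormant route-HubbardSuperconductivity-AbsenceCertificate --off` to re) — unstaffed, not closed; items shared with open routes are served there. `ledger route dormant <id> --off` reactivates.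

# Route AbsenceCertificate — Absence is certifiable — sourced d-wave order vanishing ⇒ no pair-field
LRO (Kaplan–Horsch–von der Linden/Koma–Tasaki) decides ¬S; SDP one-point certificates give the
every-GS ceiling at (8, 1/8)

NEGATIVE SIDE, REFUTATION ROUTE (card one-sided-certifiability-nogo-bootstrap; conforming successor
of the retired route OneSidedBootstrap,
whose assembly stopped at a ceiling — D-0027 §2.1). It suffices to show X :=
UniversalSourcedVanishing: for every U > 0 and every hole
doping δ ∈ (0, 1/2) there is a chemical potential μ that CANONICALLY SUPPORTS (U, δ) — the (N_L,
S^z=0)-sector ground energy of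
hubbardTorus 2 L 1 U, N_L = 2⌊(1−δ)L²/2⌋, exceeds μN_L + groundEnergy(hubbardTorusWith 2 L 1 U μ) by
o(L²) along even L — at which the
finite-volume Koma–Tasaki d-wave order parameter VANISHES: for every η > 0, m_L(h) :=
dWaveSourceDensity L U μ h = Re ω₀^{L,h}(P)/L²
(tracial ground-state functional of the SOURCED grand-canonical torus Hamiltonian dWaveSourceTorus L
U μ h = H − μN − h(P + P†),
P = pairField dWaveFormFactor L = √2·Δ_d) is ≤ η for all h ∈ (0, h₀(η)) and L ≥ L₀(h). X decides the
summit NEGATIVELY through the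
schema SourcedVanishingExcludesLRO (support, proved from the engine SourcedOrderDominatesLRO = LRO
forces sourced order, the
Kaplan–Horsch–von der Linden / Koma–Tasaki theorem direction): `closes : SourcedVanishingExcludesLRO
→ UniversalSourcedVanishing →
¬HubbardSuperconductivity` is two lines of logic (sorry-free in glue.lean). HONEST PRIOR, stated
plainly as for NoGo / PlateauExclusion /
CoboundaryCeiling: X is expected FALSE at weak coupling (a Kohn–Luttinger d-wave state has m > 0);
the route's value is REGIONAL and
INSTRUMENTAL — at the catalogued stripe point (8, 1/8) the qualitative instance
StripeSourcedVanishing (crux 4) is the SSB form of the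
numerical no-go, and its quantitative weakening StripeSourceCeiling (crux 3: m ≤ 1/20 at every
supporting μ) is CERTIFIABLE by a finite
rational one-point certificate found by the state-optimality / NPA semidefinite relaxation over
translation-invariant
pseudo-ground-states — the side of the summit on which a finite local certificate is informative (a
MAXIMUM of Re ω̃(P₀) over a convex
set containing all U(1)-averages and twisted states bounds every true sourced ground state; a
minimum is always 0) — giving the
every-ground-state ceiling StripePointCeiling (support: liminf L⁻⁴⟨Δ_d†Δ_d⟩ ≤ 1/400 for every
S-witness at (8, 1/8)).
Lean: `UniversalSourcedVanishing`

## Assembly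
Deciding theorem (glue.lean, sorry-free, lean check rc 0 in Sketch2.lean): `theorem closes (hSchema
: SourcedVanishingExcludesLRO)
(hX : UniversalSourcedVanishing) : ¬ HubbardSuperconductivity` — unfold the summit to ∃ U > 0, δ ∈
(0,1/2), M(U, δ), where M(U, δ) is the summit's matrix (the body of
Literature.Hubbard.DWaveSuperconductivityHubbard after its two existential quantifiers: every
admissible sector ground-state sequence has
d-wave pair-field LRO along even sides), and apply the schema — whose conclusion is ¬M(U, δ) INLINED
word for word — at (U, δ) to the
target's witness μ. CONE REPAIR (rev 3, 2026-08-15): the route file no longer imports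
Literature.Barriers.HubbardSuperconductivity.PureModelStripeCompetition; its abbreviation
HasDWavePairFieldLROAt U δ is the same Prop as
M(U, δ) by Iff.rfl, but that module carries the two OPEN CONJECTURES PureModelStripeCompetition /
PureModelStripeCompetitionRange
(instances of ¬S, never dischargeable as facts), which blocked staffing through the import cone.
PROVERS: Theorems files for this route
must NOT import that barrier module either (the conjectures would re-enter the cone when the gate
links your theorem) — unfold
_root_.HubbardSuperconductivity / state M(U, δ) directly, as `closes` does. Off-chain:
SourcedOrderDominatesLRO (proves the schema), SourceSlopeBound (ingredient of
the engine), CanonicalSupportingPotential + StripeSourcedVanishing (prove X at (8, 1/8):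
`universal_at_stripe_point`), StripeSourceCeiling
+ engine + CanonicalSupportingPotential (prove StripePointCeiling: `stripePointCeiling_of`).

Rationale: WHY THIS LINE. Two facts sat side by side in this sub-problem without being joined. (i) The
direction LRO ⇒ SSB is a THEOREM: a sector ground state
with pair-field LRO σ² yields, by one symmetry-broken trial state Ξ = (ψ + Oψ/‖Oψ‖)/√2
(KaplanHorschVonDerLinden1989) or by the Koma–Tasaki
tower (KomaTasaki1994 §2, §3.4; KomaTasaki1993), a lower bound on the ground-state response to the
pair source −h(P + P†) — in the tree's
own objects, dWaveSourceDensity of DWaveSource.lean — so ANY upper bound η on the sourced d-wave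
order parameter is an every-ground-state
ceiling LRO_P ≤ 2η²; this is exactly the step the barrier entry PureModelStripeCompetition records
as "assumed, not proved" between
Qin et al.'s extrapolated Δ(h_p) → 0.003(6) at μ = 1.75 (QinEtAl2020 p. 9) and the summit's LRO
language. (ii) The sourced one-point
function IS boundable by a finite certificate: the tracial ground-state functional of the sourced
torus Hamiltonian is, for every
L larger than the certificate's range, translation invariant, positive, and satisfies the
first-order optimality rows ω(a†[H,a]) ≥ 0,
ω([H,b]) = 0 — precisely the constraints of the state-optimality SDP hierarchies (AraujoEtAl2023
§6.1: magnetisations over the SET of t.i. ground states of Heisenberg models; WangEtAl2024,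
FawziFawziScalet2024, KullEtAl2024, arXiv:2410.00810), whose dual
solutions are SOS + KKT + translation-coboundary terms checkable in exact arithmetic. Imported area:
non-commutative
polynomial optimisation / SDP duality (certified computation), grafted onto finite-size SSB theory
(mathematical physics); no physical
analogy is used as evidence. What prior routes do not do: NoGo's NogoStripeWindow has "no rigorous
tool"; PlateauExclusion needs a certified pair INCOMPRESSIBILITY at commensurate sides;
CoboundaryCeiling is a state-free linear residual with no positivity cone;
GSCertificate/KacWindowPenalty work the positive side, where U(1) twists defeat finite local
certificates — here that obstruction is absent.

RANKED CRUXES. #0 UniversalSourcedVanishing (target) — for every U > 0 and δ ∈ (0, 1/2) there is μ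
with (a) [canonical support] |minEnergyOn (szSector N_L 0) (hubbardTorus 2 L 1 U) − μN_L −
groundEnergy (hubbardTorusWith 2 L 1 U μ)| ≤ εL² for all even L ≥ L₀(ε), every ε > 0, N_L =
2⌊(1−δ)L²/2⌋, and (b) [sourced vanishing] ∀ η > 0 ∃ h₀ > 0 ∀ h ∈ (0, h₀) ∃ L₀ ∀ L ≥ L₀:
dWaveSourceDensity L U μ h ≤ η. With SourcedVanishingExcludesLRO it gives ¬HubbardSuperconductivity
(glue.lean). Reached INSIDE the route (rev 8, route-choice repair) by the glue
UniversalSourcedVanishingGlue: CanonicalSupportingPotential → GlobalSourcedVanishing → X; regional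
instance (8, 1/8) via CanonicalSupportingPotential + StripeSourcedVanishing
(`universal_at_stripe_point`, Sketch2.lean). (why it might fail: Expected FALSE at weak coupling:
Kohn–Luttinger d_{x²−y²} order for 0.6 < n < 1 at t′ = 0 (RaghuKivelsonScalapino2010) makes the KT
order parameter m(U, μ) ~ e^{−c/U²} > 0 at every supporting μ; the regional instance at (8, 1/8) is
the real content.) [RaghuKivelsonScalapino2010, DengEtAl2015, ArovasBergKivelsonRaghu2022,
QinEtAl2020, KomaTasaki1994]
#2 SourcedOrderDominatesLRO (crux) — (the engine; card P1/F1 in sourced finite-volume form) for all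
real U, μ, every N : ℕ → ℕ and normalised (N_L, S^z=0)-sector ground states ψ_L of hubbardTorus 2 L
1 U (even L) whose sectors are supported by μ [o(L²) grand-canonical excess as in the target]: if
c·L⁴ ≤ Re⟨ψ_L, P†P ψ_L⟩ for all even L ≥ L₀ (c > 0) then for every h > 0 and ε > 0, √(c/2) − ε ≤
dWaveSourceDensity L U μ h for all even L ≥ L₀′. Hence dWaveOrderParameter U μ ≥ √(c/2), and
contrapositively any bound η on the sourced order parameter is the every-ground-state ceiling LRO_P
≤ 2η². Proof sketch (one KHvdL trial state Ξ = (ψ + Oψ/‖Oψ‖)/√2, O = P + P†, no tower, no RP; ⟨O⟩ =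
⟨O³⟩ = 0 in a number eigenstate, double commutator ‖[[O, H − μN], O]‖ ≤ C₂L², variational principle
for dWaveSourceTorus + SourceSlopeBound; full text in the item docstring): L²·m_L(h) ≥ ⟨Ξ,OΞ⟩/2 −
[C₂/(4cL²) + g_L(μ)]/(2h), g_L(μ) = o(L²). Ranked 2: the hardest honest Lean work, unblocked today,
and the bridge the barrier entry PureModelStripeCompetition records as 'assumed, not proved'. [deps:
SourceSlopeBound] [difficulty: L] (why it might fail: As typed: bond pair densities overlap (KT
hypothesis i) fails), so ‖[[O,H−μN],O]‖ ≤ C·L² and ‖[P,P†]‖ ≤ C·L² need a locality recount; the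
o(L²) ensemble clause and groundEnergy/minEnergyOn junk values at empty sectors must be fenced. On
paper it is KHvdL 1989 / KT 1994 §3.4.) [KaplanHorschVonDerLinden1989, KomaTasaki1994,
KomaTasaki1993, doi:10.1007/bf02097237, HorschVonDerLinden1988, Tasaki1998,
Literature.Barriers.HubbardSuperconductivity.LROForcesLowLyingStates,
Literature.MathematicalPhysics.QuantumLattice.dWaveSourceDensity]
#3 StripeSourceCeiling (crux) — (card K1, the CERTIFIABLE bet, typed without the SDP objects) for
every μ that canonically supports (8, 1/8) there is h₀ > 0 such that for all h ∈ (0, h₀) and all L ≥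
L₀(h): dWaveSourceDensity L 8 μ h ≤ 1/20. Discharge path (layer 2, typed rev 1): OnePointSoundness +
StripeOnePointCertificate — a degree-R ONE-POINT CERTIFICATE (SOS + KKT rows a_k†[H_{L,μ,h}, a_k] +
[H_{L,μ,h}, b] + translation coboundaries writing 1/20·1 − (P₀ + P₀†)/2, H_{L,μ,h} =
dWaveSourceTorus L 8 μ h, P₀ = localPair dWaveFormFactor L 0), evaluated in the tracial sourced
ground-state functional, found by the state-optimality / NPA SDP with rational rounding, uniform on
the (μ, h)-box (full text in the item docstring). With the engine and CanonicalSupportingPotential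
it yields StripePointCeiling (proved in Sketch2.lean as `stripePointCeiling_of`). [difficulty: XL]
(why it might fail: The relaxation must price out d-wave pseudo-states only ≈0.01t/site above the
stripe state (QinEtAl2020 §III.C); 2-positivity-level fermionic constraints are far too loose at U=8
(VerstichelEtAl2012), so the needed range R may be out of reach — or m(8, μ) > 1/20 in truth.)
[QinEtAl2020, AraujoEtAl2023, WangEtAl2024, FawziFawziScalet2024, KullEtAl2024, VerstichelEtAl2012,
arXiv:2410.00810, doi:10.1103/physrevlett.108.213001]
#4 StripeSourcedVanishing (crux) — (the qualitative regional bet: the SSB form of the catalogued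
stripe no-go, = the instance of X at (8, 1/8) given CanonicalSupportingPotential) for every μ that
canonically supports (8, 1/8) and every η > 0 there is h₀ > 0 such that for all h ∈ (0, h₀) and L ≥
L₀(h): dWaveSourceDensity L 8 μ h ≤ η — the Koma–Tasaki d-wave order parameter of the pure model
VANISHES at hole doping 1/8, U = 8 (numerically: the AFQMC pairing order parameter extrapolated in
width then field, Δ_∞(0) = 0.003(6) at μ = 1.75, QinEtAl2020 Fig. 9). Certificates (crux 3) approach
it from above (η_R ↓) but never reach η = 0; an exact proof needs a structural input (e.g. a
certified stripe charge order plus a selection rule), deliberately not decomposed. [deps: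
CanonicalSupportingPotential] [difficulty: open-problem] (why it might fail: No known tool proves
EXACT vanishing of an SSB order parameter at intermediate coupling (SDP certificates stop at η_R >
0); numerics contested (Sorella2023, MaierEtAl2005); a 7/8-plateau endpoint μ± may also support a
superconducting density outside the window.) [QinEtAl2020, XuEtAl2024, Sorella2023, MaierEtAl2005,
ArovasBergKivelsonRaghu2022,
Literature.Barriers.HubbardSuperconductivity.PureModelStripeCompetition]
#6 GlobalSourcedVanishing (crux, added rev 8 — the NAMED CONDITION the target is conditional on) —
for every U > 0, δ ∈ (0, 1/2) and EVERY μ that canonically supports (U, δ): ∀ η > 0 ∃ h₀ > 0 ∀ h ∈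
(0, h₀) ∃ L₀ ∀ L ≥ L₀, dWaveSourceDensity L U μ h ≤ η (no d_{x²−y²} symmetry breaking under an
infinitesimal pair source anywhere in the summit's box). StripeSourcedVanishing = its instance at
(8, 1/8) (`stripeSourcedVanishing_of_global`, rc 0); with CanonicalSupportingPotential it gives X
(glue below). Ranked LAST on purpose: the route's global bet, to be decided not believed; provers
work cruxes 3–5. [deps: CanonicalSupportingPotential] [difficulty: open-problem] (why it might fail:
Expected FALSE at weak coupling — Kohn–Luttinger/RG d_{x²−y²} order for 0.6 < n < 1 at t′ = 0
(RaghuKivelsonScalapino2010 arXiv p. 7, DengEtAl2015 Fig. 1) ⇒ m(U, μ) > 0 at supporting μ for small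
U; Sorella2023 Fig. 12 even claims pure-model d-wave SC at U = 8, δ ≈ 0.19–0.25.)
[RaghuKivelsonScalapino2010, DengEtAl2015, Sorella2023, ArovasBergKivelsonRaghu2022, QinEtAl2020,
KomaTasaki1994, Literature.Barriers.HubbardSuperconductivity.WeakCouplingCeiling]
#9 SourcedVanishingExcludesLRO (support) — (schema in the deciding chain) for every U > 0 and δ ∈
(0, 1/2): if some μ canonically supports (U, δ) and the sourced d-wave order vanishes there (clauses
(a), (b) of the target), then the summit's matrix FAILS at (U, δ) — NOT every admissible (N_L,
S^z=0)-sector ground-state sequence has d-wave pair-field LRO along even sides (in fact none has);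
the conclusion is the matrix of Literature.Hubbard.DWaveSuperconductivityHubbard inlined (rev 3 cone
repair: = ¬HasDWavePairFieldLROAt U δ of the barrier file by Iff.rfl, which is deliberately NOT
imported — do not import it in Theorems files either). Proof from SourcedOrderDominatesLRO: an
admissible all-sides sequence exists (Theorems/NoGoNogoThesis `exists_groundStateInSector_seq`); if
it had LRO, the normal form Σ_{x,y∈halfOpenBox 2 (2k)} torusPullback (pairFieldCorr dWaveFormFactor
ψ) (2k) x y = Re⟨ψ_{2k}, P†P ψ_{2k}⟩ and liminf > 0 ⇒ an eventual bound c·L⁴ ≤ Re⟨P†P⟩ (c > 0) along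
even L; the engine gives m_L(h) ≥ √(c/2) − ε eventually, contradicting vanishing with η = √(c/2)/4.
The restriction to U > 0, δ ∈ (0, 1/2) fences the junk regime δ < −1 (empty sectors). [deps:
SourcedOrderDominatesLRO] [difficulty: M] [KomaTasaki1994, KaplanHorschVonDerLinden1989,
Scalapino1995, ArovasBergKivelsonRaghu2022]
#9 SourceSlopeBound (support) — for every L, U, μ and h > 0: (groundEnergy (dWaveSourceTorus L U μ
0) − groundEnergy (dWaveSourceTorus L U μ h))/(2h) ≤ L²·dWaveSourceDensity L U μ h = Re ω₀^{L,h}(P).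
Proof: h ↦ E_L(h) = λ_min(H_μ − hO) is concave (infimum of affine functions); its left derivative at
h is −λ_min of O compressed to the ground space of H_μ − hO (first-order degenerate perturbation
theory), which is ≤ the tracial average ω₀^{L,h}(O) = 2 Re ω₀^{L,h}(P); the supergradient inequality
gives (E_L(0) − E_L(h))/h ≤ −E_L′(h−). Abstract lemma: Hermitian A, O, h > 0 ⇒ (λ_min(A) − λ_min(A −
hO))/h ≤ Re (groundStateFunctional (A − hO) O). [difficulty: provable-now]
[KaplanHorschVonDerLinden1989, Griffiths1966, Kato1966, Tasaki2020]
#9 CanonicalSupportingPotential (support) — (T = 0 equivalence of ensembles for the Hubbard torus)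
for every real U and δ ∈ (0,1) there is μ such that |minEnergyOn (szSector N_L 0) (hubbardTorus 2 L
1 U) − μ·N_L − groundEnergy (hubbardTorusWith 2 L 1 U μ)| ≤ εL² for all even L ≥ L₀(ε), N_L = 2⌊(1 −
δ)L²/2⌋. Proof: existence of the ground-state energy density e(ρ) = lim E_L(N_L(ρ))/L² (block
decomposition of the torus, boundary hopping costs O(L), sector energies are C-Lipschitz in N), its
convexity (two half-tori), groundEnergy(H − μN)/L² → min_ρ (e(ρ) − μρ), and μ any subgradient of e
at 1 − δ (all subgradients lie in [−4, 4 + U⁺]). The S^z = 0 restriction is immaterial (N_L even ⇒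
every spin multiplet of the N_L-sector ground space has an S^z = 0 member). Library value: the
canonical ↔ grand-canonical dictionary every sourced-order-parameter route (WeakCouplingBCS,
ChiralWindow, AposterioriCapRg) needs. [difficulty: M] [Ruelle1969, Simon1993, Griffiths1966,
LiebWu1968]
#9 StripePointCeiling (support) — (the quantitative every-ground-state corollary — the certifiable
deliverable in the summit's own units; target of the retired route) every admissible sequence at (U,
δ) = (8, 1/8) — N_L = 2⌊(7/8)L²/2⌋, ψ_L normalised (N_L, S^z=0)-sector ground states of hubbardTorus
2 L 1 8 at even L — obeys: every eventual lower bound c·L⁴ ≤ Re⟨ψ_L, P†P ψ_L⟩ along even L has c ≤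
1/200, i.e. liminf L⁻⁴⟨Δ_d†Δ_d⟩ ≤ 1/400 (P = √2Δ_d): any S-witness at the catalogued stripe point
has Scalapino constant ≤ 1/400 (bond singlet amplitude ≤ 1/80 in Qin et al.'s normalisation, below
the t′ = −0.2 model's 0.017(3)). PROVED in Sketch2.lean from SourcedOrderDominatesLRO +
CanonicalSupportingPotential + StripeSourceCeiling by pure logic (`stripePointCeiling_of`).
[difficulty: provable-now] [QinEtAl2020, XuEtAl2024, KomaTasaki1994]
#9 UniversalSourcedVanishingGlue (support, added rev 8) — CanonicalSupportingPotential →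
GlobalSourcedVanishing → UniversalSourcedVanishing: the glue that makes the cruxes reach the target
(needs_repair route.target-unreachable). Pure logic (δ ∈ (0,1/2) ⊂ (0,1); take CSP's μ; apply #6 at
(U, δ, μ)), proved in the planner's Sketch.lean `universalOfGlobal_proof` (rc 0, 0 sorries); a
prover lands it verbatim. [difficulty: provable-now] [KomaTasaki1994, Ruelle1969]

TWO-LAYER PLAN. Foreseen glued splits (nothing filed now beyond the informal items named in §
Definition requests):
StripeSourceCeiling ⇐ OnePointSoundness → StripeOnePointCertificate → PotentialBracket →
StripeSourceCeiling (k = 3), the definition DWaveOnePointCertificate having landed (p43150) —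
OnePointSoundness (support, typed rev 1: positivity, KKT rows and translation invariance of the
tracial ground-state functional of H = dWaveSourceTorus L U μ h, Re ω₀(P)/L² = Re ω₀(P₀));
StripeOnePointCertificate (crux 5, typed rev 1: ∃ R, h₀ with a certificate at (8, μ, h, 1/20) for
every supporting μ, h ∈ (0, h₀)); PotentialBracket (every supporting μ
of (8, 1/8) lies in [μ₁, μ₂]; a priori [−4, 12], sharpened by certified energy bounds; not filed).
SourcedOrderDominatesLRO ⇐ TrialStateOrder
(⟨Ξ,OΞ⟩, ⟨O³⟩ = 0, ‖[P,P†]‖ ≤ C L²) → DoubleCommutatorBudget (‖[[O, H − μN], O]‖ ≤ C(U,μ)L², the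
same count
PlateauExclusion.PairGapCeiling and CoboundaryCeiling.CeilingLemma need — share it via --supports) →
glue with SourceSlopeBound (k = 2).
UniversalSourcedVanishing ⇐ CanonicalSupportingPotential → GlobalSourcedVanishing (glue
UniversalSourcedVanishingGlue, FILED rev 8); GlobalSourcedVanishing ⇐ regional instances (stripe
point = StripeSourcedVanishing; Nagaoka corner U ≥ U₁(δ), δ ≤ δ₁ via saturated ferromagnetism + the
proved singlet selection rule Theorems/NoGoNogoSingletPairKillsSaturatedFM, card K2) + the
weak-coupling complement, which is NOT expected to close (honest prior above) — no further split is
filed.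

KILL CRITERIA. (a) StripeSourcedVanishing or StripeSourceCeiling refuted — some supporting μ with
m_L(h) ≥ η₀ > 0 persistently (a certified LOWER
bound on the sourced order parameter, or a proof of d-wave LRO at (8, 1/8), which refutes X at that
point as well) ⇒ close
`refuted:StripeSourcedVanishing`: the pure model then superconducts at 1/8; hand the point to S-side
routes. (b) PRACTICAL kill (the
card's fastest refutation): floating-point η_R(8, μ ≈ 1.75, h ≈ 0.01–0.05) at the largest feasible
level (3×3 / 4×4-site boxes, KKT
degree ≥ 3) not visibly below its U = 2 value, or ≥ 0.3 ⇒ the hierarchy cannot resolve the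
competition scale: close `exhausted`,
keeping SourcedOrderDominatesLRO, SourceSlopeBound, CanonicalSupportingPotential,
SourcedVanishingExcludesLRO as shared support (they
serve NoGo, PlateauExclusion, ChiralWindow, AposterioriCapRg regardless) and recording the
certified-but-weak η_R as a support
statement. (c) SourcedOrderDominatesLRO refuted AS TYPED ⇒ restate once (KHvdL/KT on paper; a
refutation exposes a typing slip); a second refutation closes the route. (d) GlobalSourcedVanishing
(hence X) refuted by a proof of sourced d-wave order or d-wave LRO at some weak
coupling (WeakCouplingBCS cruxes) ⇒ the route is BROKEN on its global bet: a regional restatement (U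
∈ [6,8], δ ∈ [1/10,1/6]) no
longer reaches ¬S, so the regional theorems are handed to NoGo as shared statements and the route
closes `refuted:GlobalSourcedVanishing`.

NOT DECOMPOSED YET. PotentialBracket (supporting μ of (8, 1/8) ∈ [μ₁, μ₂]); the symmetry reduction
of the SDP (translations × axis reflections × SU(2) × spin flip; the B1g source is odd
under the 90° rotation, so use rotation∘(U(1) phase π)); the SHARP constant LRO_P ≤ m² (KT (2.30)
via the tower — needs
the overlapping-support variant of theorem_2_3 / Theorem 2.5; a ceiling does not need it); the box
version U ∈ [6, 8] × δ ∈ [1/10, 1/6]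
(U affine in the rows ⇒ SOS-in-U multipliers); the Nagaoka corner (card K2); infinite-volume
completeness η_R ↓ max SSB amplitude over
t.i. ground states (Fawzi–Fawzi–Scalet-type convergence + Bratteli–Kishimoto–Robinson) — reassuring,
never load-bearing for a ceiling;
calibration theorems at U = 0 (sourced free gas, BdG blocks: WeakCouplingBCS support
WcbcsSourcedFreeGasCooperLog) and U < 0;
the restatement of crux 2 over the INTERIOR of the supporting interval should a coexistence endpoint
μ± of a 7/8-plateau also support a
superconducting density outside the stripe window (then the sourced grand-canonical functional sees
that density, not 7/8).

CHEAPEST FALSIFIER. (i) Typing: `lean check` rc 0 of the planners' Sketch2.lean (decls, `closes`,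
`universal_at_stripe_point`, `stripePointCeiling_of`) and rev-8 Sketch.lean
(`universalOfGlobal_proof`, `stripeSourcedVanishing_of_global`, `closes_of_global`), no sorry. (ii)
The line: one floating-point run of
the one-point SDP at level (2×2-site box, KKT degree 2) and (3×2) at (U, μ, h) = (8, 1.75, 0.05)
against (2, μ_free(7/8), 0.05) and
against the exactly solvable U = 0 sourced free gas (BdG blocks): if η_R(8) is not below η_R(2) and
below ≈ 0.3, kill (b) fires before
any Lean is written (kit job; not run in this one-shot planning session). (iii) Lookup (done by
retriage rev 2: KT1994 §2.7 Rem. 2, Tasaki2019Tower ⇒ the engine is support, not crux).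

NUMBERS. Normalisations: P = pairField dWaveFormFactor L = Σ_x localPair = √2·Δ_d (Statement.lean
docstring); localPair P_x = Σ_{e=±e₁,±e₂} g_d(e) b_{x,x+e}
with b_{ij} = (c_{i↑}c_{j↓} − c_{i↓}c_{j↑})/√2 = Qin et al.'s Δ̂_ij (arXiv:1910.08931 Eq. (2)), so m
:= Re ω(P₀) = 4·Δ_bond; our source
−h(P + P†) = −2h Σ_bonds ±(b + b†) vs their −Σ h_p(Δ̂ + Δ̂†)/2 (Eq. (5)) ⇒ h_p = 4h. AFQMC at U = 8:
"The chemical potential μ = 1.75 is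
chosen such that the hole density is h = 1/8" (p. 9); Δ_∞(0) = 0.003(6) (p. 9, Fig. 9) ⇒ m ≈
0.012(24). t′ = −0.2, hole doping 1/8:
Δ = 0.017(3) (arXiv:2303.08376 SM p. 14) ⇒ m ≈ 0.068. Threshold 1/20 on m ⇔ Δ_bond ≤ 0.0125: below
the t′-model superconductor, 4× above
the pure-model central value. Target ceiling: LRO_P ≤ 2·(1/20)² = 1/200 ⇔ liminf L⁻⁴⟨Δ_d†Δ_d⟩ ≤
1/400. Competition scale the SDP must resolve: stripe vs uniform d-wave ≈ 0.01t per site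
(QinEtAl2020 §III.C, Fig. 10); certified SDP energy windows today: a few per cent of |e₀|
(WangEtAl2024; KullEtAl2024). A-priori potential bracket: subgradients of e on (0, 2) lie in [−4, 4
+ U] = [−4, 12].
Items (rev 8): 13 — target, 4 cruxes (ranks 3–6), 7 supports, assembly.

DEFINITION REQUESTS. DWaveOnePointCertificate (R : ℕ) (U μ h η : ℝ) — NEW OBJECT posited for this
problem (topic Summits/HubbardSuperconductivity/HubbardSuperconductivity/Theorems;
cf. the positive-side interface of route GSCertificate): L-independent finite data — polynomials in
the torus CAR generators supported
in translates of the R-box: SOS generators s_j, KKT multipliers a_k, an arbitrary b, translation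
coboundaries (x_i, B_i), and L₀ — such
that for every L ≥ L₀ the operator identity η·1 − (P₀ + P₀†)/2 = Σ_j s_j†s_j + Σ_k a_k†(H a_k − a_k
H) + (H b − b H) + Σ_i (τ_{x_i}(B_i) − B_i)
holds on Fock((ℤ/Lℤ)²) with H = dWaveSourceTorus L U μ h and P₀ = localPair dWaveFormFactor L 0 (τ =
torus translation of orbitals).
LANDED (p43150) as Literature.MathematicalPhysics.QuantumLattice.DWaveOnePointCertificate; the
layer-2 items OnePointSoundness (support) and StripeOnePointCertificate (crux 5) are typed over it
(rev 1). No Literature fact is requested: the sourced inequality is to be PROVED.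

Novelty: Searches (2026-08-15): `lit read paper:arxiv-cond-mat_9708132` (KT 1994: §2 Thms 2.2–2.5, Cor. 2.9,
§2.7 Remark 2 p. 11 "existence of a
symmetry breaking in the [sourced] state … proved in [KaplanHorschLinden, KomaTasaki]", §3.4 lattice
electrons "with some extra care");
`lit read paper:arxiv-1910.08931` pp. 4, 9 and `lit read arxiv:2303.08376` SM p. 14 (numbers above);
`lit search --source crossref` ×6:
"Kaplan Horsch von der Linden order parameter …" (doi:10.1143/jpsj.58.3894,
doi:10.1103/physrevb.42.4663), "Koma Tasaki symmetry breaking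
Heisenberg antiferromagnets" (doi:10.1007/bf02097237, doi:10.1103/physrevlett.70.93), "certified
bounds superconducting order parameter
Hubbard semidefinite reduced density matrix" (10 rows: 2-RDM SDPs doi:10.1063/1.1360199,
doi:10.1103/physreva.73.062505,
doi:10.1103/physrevb.50.6519 — variational energies, no certified upper bound on an SSB amplitude),
"Verstichel … 2D Hubbard"
(doi:10.1103/physrevlett.108.213001), "noncommutative polynomial optimization ground state local
observables bounds" (10 rows, none on
order parameters of lattice fermions), "absence of superconducting long-range order ground state
Hubbard rigorous upper bound"
(doi:10.1016/s0375-9601(97)00204-1 Su–Schadschneider–Zittartz, doi:10.1103/physrevb.45.3145 Tian —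
Bogoliubov-inequality no-go needing a
gap / negative-U exact ODLRO); `lit vsearch` ×3 (sourced order parameter vs LRO; SDP certified
bounds on observables — 10 held BOOKS each, none relevant: Fradkin,
Altland–S  [refs: 10.1143/jpsj.58.3894, 10.1103/physrevb.42.4663, 10.1007/bf02097237, 10.1103/physrevlett.70.93, 10.1063/1.1360199, 10.1103/physreva.73.062505, 10.1103/physrevb.50.6519, 10.1103/physrevlett.108.213001, 10.1016/s0375-9601(97, 10.1103/physrevb.45.3145, 10.1103/PhysRevX.14.031006, 2303.08376, 2311.18707, 2410.00810, paper:arxiv-cond-mat_9708132, paper:arxiv-1910.08931, arxiv:2303.08376, doi:10.1143/jps]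

Barriers (technique_class: SDP-bootstrap-upper-bound, Koma-Tasaki-contrapositive): - technique_class: SDP-bootstrap-upper-bound, Koma-Tasaki-contrapositive
- Literature.Barriers.HubbardSuperconductivity.PureModelStripeCompetition: not fought but
instrumented — this route is the tool that moves the catalogued NUMERICAL obstruction (Δ_∞(0) =
0.003(6) at μ = 1.75) toward theorems: its KT reading (SsbReadingOfStripeNoGo) becomes provable and
its quantitative shadow (StripePointCeiling) certifiable; the entry's 'contested' status
(Sorella2023, MaierEtAl2005) is the why-might-fail of StripeSourceCeiling.
- Literature.Barriers.HubbardSuperconductivity.SignProblemNPHard: evaded in kind — no sampling; a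
deterministic SDP whose dual certificate is verified in exact arithmetic; NP-hardness of generic
ground-state problems returns only as slow convergence in the level R (kill (b)), never as an
uncontrolled bias.
- Literature.Barriers.HubbardSuperconductivity.LROForcesLowLyingStates: USED in the theorem
direction (LRO ⇒ a low-lying symmetry-broken trial state ⇒ sourced order), with its scope caveat
respected: nothing infers LRO from SSB (KT Conj. 10 stays open and unused); the failure of KT's
hypothesis i) for overlapping bond pair densities is flagged as crux 3's why-might-fail.
- Literature.Barriers.HubbardSuperconductivity.GeneralizedHartreeFockNoPairing: irrelevant to
validity — no quasi-free variational class is assumed; BCS-like pseudo-states are feasible points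
that KKT rows of degree ≥ 3 must price out (it predicts that degree-2 relaxations are loose, cf.
Versti

Novelty grade: new-combination — route-review grade (refuter-rreview-0815T13-25-0): NEW-COMBINATION. Prior art: Kaplan–Horsch–von der Linden 1989 doi:10.1143/jpsj.58.3894, Koma–Tasaki 1994 (§2, §3.4) — LRO ⇒ sourced symmetry breaking (theorem direction); state-optimality/NPA SDP certificates for local ground-state observables of t. (refuter refuter-rreview-0815T13-25-0, 2026-08-15T14:51:18Z; prior: doi:10.1143/jpsj.58.3894,KomaTasaki1994,AraujoEtAl2023,doi:10.1103/PhysRevX.14.031006,FawziFawziScalet2024,KullEtAl2024,arXiv:2410.00810,arXiv:1910.08931)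

History (route lifecycle, newest last):
- 2026-08-15T16:11:54Z · rev 3: restated SourcedVanishingExcludesLRO (stmt-HubbardSuperconductivity-9489) — cone repair (route-repair g2): drop import Literature.Barriers.HubbardSuperconductivity.PureModelStripeCompetition — its two named claims PureModelStripeCompeti (planner-rrepair-HubbardSuperconductivity-Absen-3b8517f1-g2-0)
- 2026-08-16T03:30:35Z · rev 9: restated UniversalSourcedVanishingGlue (stmt-HubbardSuperconductivity-14357) — route-choice follow-up (rev 9): restate the glue item UniversalSourcedVanishingGlue 1:1 with the statement of CanonicalSupportingPotential INLINED word for word (planner-rchoice-HubbardSuperconductivity-Absen-11022375-0)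
- 2026-08-16T04:06:07Z · AUTO-CRUX (backfill): UniversalSourcedVanishing — hypotheses of the deciding theorem that nothing in the route derives are cruxes (operator:999:1085951)
- 2026-08-22T09:16:08Z · DORMANT — reconciler: no traction for 5.2 d (last activity item-evidence-added at 2026-08-17T03:03:09Z); parked, not closed — `ledger route dormant route-HubbardSupercond (operator:999:3670093)

sub-problem: HubbardSuperconductivity · status: dormant · opened planner-plancard-HubbardSuperconductivity-Hub-6df3989b-0 2026-08-15T13:58:34Z · rev 9 · ledger route-HubbardSuperconductivity-AbsenceCertificate
GENERATED by the gate from the ledger (D-0016/17). Provers cite these decls: `theorem foo : Summit.HubbardSuperconductivity.HubbardSuperconductivity.Theses.AbsenceCertificate.<Decl> := …` in Summits/HubbardSuperconductivity/HubbardSuperconductivity/Theorems/<Name>.lean.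
-/

namespace Summit.HubbardSuperconductivity.HubbardSuperconductivity.Theses.AbsenceCertificate

open scoped BigOperators Topology Manifold Classical MeasureTheory ProbabilityTheory Matrix InnerProductSpace ComplexConjugate ContinuousMap
open Filter Set Function TopologicalSpace MeasureTheory

attribute [summit_statement] _root_.HubbardSuperconductivity

open Literature.Hubbard

/-- item stmt-HubbardSuperconductivity-9485 · crux (kind.auto-crux: conjecture-grade) · rank 0 · open · by planner
why it might fail: Expected FALSE globally: weak-coupling RG/diagrammatics give d_{x²−y²} order for 0.6<n<1 at t′=0 (RaghuKivelsonScalapino2010 §III.B; DengEtAl2015 Fig. 1), so m(U,μ)>0 at every supporting μ for small U>0; only the regional instance (8,1/8) is a live bet — X is filed to be decided, not believed.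
sources: RaghuKivelsonScalapino2010, DengEtAl2015, ArovasBergKivelsonRaghu2022, QinEtAl2020, KomaTasaki1994, Literature.Barriers.HubbardSuperconductivity.WeakCouplingCeiling
[target] for every U > 0 and δ ∈ (0, 1/2) there is μ with (a) [canonical support] |minEnergyOn
(szSector N_L 0) (hubbardTorus 2 L 1 U) − μN_L − groundEnergy (hubbardTorusWith 2 L 1 U μ)| ≤ εL²
for all even L ≥ L₀(ε), every ε > 0, N_L = 2⌊(1−δ)L²/2⌋, and (b) [sourced vanishing] ∀ η > 0 ∃ h₀ >
0 ∀ h ∈ (0, h₀) ∃ L₀ ∀ L ≥ L₀: dWaveSourceDensity L U μ h ≤ η. With SourcedVanishingExcludesLRO it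
gives ¬HubbardSuperconductivity (glue.lean). Regional instances: (8, 1/8) via
CanonicalSupportingPotential + StripeSourcedVanishing (proved in the planner's Sketch2.lean as
`universal_at_stripe_point`). -/
@[route_item "route-HubbardSuperconductivity-AbsenceCertificate", crux]
def UniversalSourcedVanishing : Prop :=
  ∀ U : ℝ, 0 < U → ∀ δ : ℝ, δ ∈ Set.Ioo (0:ℝ) (1 / 2) → ∃ μ : ℝ, (∀ ε : ℝ, 0 < ε → ∃ L₀ : ℕ, ∀ L : ℕ, Even L → L₀ ≤ L → |(Literature.MathematicalPhysics.QuantumLattice.hubbardTorus 2 L 1 U).minEnergyOn (Literature.MathematicalPhysics.QuantumLattice.szSector (2 * ⌊(1 - δ) * (L : ℝ) ^ 2 / 2⌋₊) 0) - μ * ((2 * ⌊(1 - δ) * (L : ℝ) ^ 2 / 2⌋₊ : ℕ) : ℝ) - Matrix.groundEnergy (Literature.MathematicalPhysics.QuantumLattice.hubbardTorusWith 2 L 1 U μ)| ≤ ε * (L : ℝ) ^ 2) ∧ (∀ η : ℝ, 0 < η → ∃ h₀ : ℝ, 0 < h₀ ∧ ∀ h : ℝ, h ∈ Set.Ioo (0:ℝ)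 h₀ → ∃ L₀ : ℕ, ∀ (L : ℕ) [NeZero L], L₀ ≤ L → Literature.MathematicalPhysics.QuantumLattice.dWaveSourceDensity L U μ h ≤ η)

/-- item stmt-HubbardSuperconductivity-9487 · crux · rank 3 · open · by planner
why it might fail: False if m(8,μ)>1/20 at a supporting μ: AFQMC m=4Δ_∞(0)=0.012±0.024 at μ=1.75 (QinEtAl2020 p.9) puts 1/20 <2σ away; a 7/8-plateau endpoint μ± may carry a nearby superconducting density (Sorella2023); uncertifiable if SDP rows cannot resolve the ≈0.01t/site stripe–d-wave gap (VerstichelEtAl2012).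
sources: QinEtAl2020, Sorella2023, VerstichelEtAl2012, AraujoEtAl2023, WangEtAl2024, FawziFawziScalet2024
[crux] (card K1, the CERTIFIABLE bet, typed without the SDP objects) for every μ that canonically
supports (8, 1/8) there is h₀ > 0 such that for all h ∈ (0, h₀) and all L ≥ L₀(h):
dWaveSourceDensity L 8 μ h ≤ 1/20. Discharge path (layer 2, after the definition request lands): a
degree-R ONE-POINT CERTIFICATE — L-independent box-supported CAR polynomials s_j (SOS), a_k (KKT
multipliers), b, and (x_i, B_i) (translation coboundaries) with 1/20·1 − (P₀ + P₀†)/2 = Σ s_j†s_j +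
Σ a_k†[H_{L,μ,h}, a_k] + [H_{L,μ,h}, b] + Σ (τ_{x_i}B_i − B_i) on Fock((ℤ/Lℤ)²) for all L ≥ L₀,
H_{L,μ,h} = dWaveSourceTorus L 8 μ h, P₀ = localPair dWaveFormFactor L 0 — evaluated in the tracial
sourced ground-state functional (positive, translation invariant, ω(a†[H,a]) ≥ 0, ω([H,b]) = 0) it
gives m_L(h) ≤ 1/20; found by the state-optimality / NPA SDP with rational rounding, uniform on the
(μ, h)-box by SOS multipliers (μ, h, U enter the rows affinely). With the engine and
CanonicalSupportingPotential it yields StripePointCeiling (proved in Sketch2.lean as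
`stripePointCeiling_of`). [difficulty: XL] -/
@[route_item "route-HubbardSuperconductivity-AbsenceCertificate", crux]
def StripeSourceCeiling : Prop :=
  ∀ μ : ℝ, (∀ ε : ℝ, 0 < ε → ∃ L₀ : ℕ, ∀ L : ℕ, Even L → L₀ ≤ L → |(Literature.MathematicalPhysics.QuantumLattice.hubbardTorus 2 L 1 8).minEnergyOn (Literature.MathematicalPhysics.QuantumLattice.szSector (2 * ⌊(1 - 1 / 8) * (L : ℝ) ^ 2 / 2⌋₊) 0) - μ * ((2 * ⌊(1 - 1 / 8) * (L : ℝ) ^ 2 / 2⌋₊ : ℕ) : ℝ) - Matrix.groundEnergy (Literature.MathematicalPhysics.QuantumLattice.hubbardTorusWith 2 L 1 8 μ)| ≤ ε * (L : ℝ) ^ 2) → ∃ h₀ : ℝ, 0 < h₀ ∧ ∀ h : ℝ, h ∈ Set.Ioo (0:ℝ) h₀ → ∃ L₀ : ℕ, ∀ (L : ℕ) [NeZero L], L₀ ≤ L → Literature.MathematicalPhysics.QuantumLattice.dWaveSourceDensity L 8 μ h ≤ 1 / 20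

/-- item stmt-HubbardSuperconductivity-9488 · crux · rank 4 · open · by planner
why it might fail: No known tool proves EXACT vanishing of an SSB order parameter at intermediate coupling (certificates stop at η_R>0); numerics contested (Sorella2023 d-wave away from 1/8; MaierEtAl2005; ABKR2022 §8.1 'unsettled'); a 7/8-plateau endpoint μ± may support a superconducting density outside the window.
sources: QinEtAl2020, XuEtAl2024, Sorella2023, MaierEtAl2005, ArovasBergKivelsonRaghu2022, Literature.Barriers.HubbardSuperconductivity.PureModelStripeCompetition
[crux] (the qualitative regional bet: the SSB form of the catalogued stripe no-go, = the instance of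
X at (8, 1/8) given CanonicalSupportingPotential) for every μ that canonically supports (8, 1/8) and
every η > 0 there is h₀ > 0 such that for all h ∈ (0, h₀) and L ≥ L₀(h): dWaveSourceDensity L 8 μ h
≤ η — the Koma–Tasaki d-wave order parameter of the pure model VANISHES at hole doping 1/8, U = 8
(numerically: the AFQMC pairing order parameter extrapolated in width then field, Δ_∞(0) = 0.003(6)
at μ = 1.75, QinEtAl2020 Fig. 9). Certificates (crux 3) approach it from above (η_R ↓) but never
reach η = 0; an exact proof needs a structural input (e.g. a certified stripe charge order plus a
selection rule), deliberately not decomposed. [deps: CanonicalSupportingPotential] [difficulty: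
open-problem] -/
@[route_item "route-HubbardSuperconductivity-AbsenceCertificate"]
def StripeSourcedVanishing : Prop :=
  ∀ μ : ℝ, (∀ ε : ℝ, 0 < ε → ∃ L₀ : ℕ, ∀ L : ℕ, Even L → L₀ ≤ L → |(Literature.MathematicalPhysics.QuantumLattice.hubbardTorus 2 L 1 8).minEnergyOn (Literature.MathematicalPhysics.QuantumLattice.szSector (2 * ⌊(1 - 1 / 8) * (L : ℝ) ^ 2 / 2⌋₊) 0) - μ * ((2 * ⌊(1 - 1 / 8) * (L : ℝ) ^ 2 / 2⌋₊ : ℕ) : ℝ) - Matrix.groundEnergy (Literature.MathematicalPhysics.QuantumLattice.hubbardTorusWith 2 L 1 8 μ)| ≤ ε * (L : ℝ) ^ 2) → ∀ η : ℝ, 0 < η → ∃ h₀ : ℝ, 0 < h₀ ∧ ∀ h : ℝ, h ∈ Set.Ioo (0:ℝ) h₀ → ∃ L₀ : ℕ, ∀ (L : ℕ) [NeZero L], L₀ ≤ L → Literature.MathematicalPhysics.QuantumLattice.dWaveSourceDensity L 8 μ h ≤ η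

/-- item stmt-HubbardSuperconductivity-9686 · crux · rank 5 · open · by planner
why it might fail: No certificate of THIS shape may exist even if m≤1/20: one level R must serve all h∈(0,h₀) and every supporting μ (unknown bracket ⊂[−4,12]); fixed-R fermionic relaxations are loose at U=8 (VerstichelEtAl2012), 4^|box| caps R; false outright if m(8,μ)>1/20 (QinEtAl2020 p.9: <2σ from AFQMC value).
sources: QinEtAl2020, VerstichelEtAl2012, AraujoEtAl2023, WangEtAl2024, FawziFawziScalet2024, KullEtAl2024
[crux] (card K1; CERTIFIED COMPUTATION; layer 2 of StripeSourceCeiling) there are a level R and h₀ >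
0 such that for every μ canonically supporting (8, 1/8) and every h ∈ (0, h₀) a
DWaveOnePointCertificate R 8 μ h (1/20) exists. With OnePointSoundness this gives
StripeSourceCeiling by pure logic (planner Sketch3.lean `stripeSourceCeiling_of`). WORK PROGRAMME:
(1) primal SDP = maximise Re ω̃(P₀) over translation-invariant pseudo-expectations on R-box CAR
words with moment positivity, symmetry reduction (translations × axis reflections × SU(2)_spin ×
spin flip; the B1g source is odd under the 90° rotation — use rotation∘(U(1) phase π)), KKT rows
ω̃(aᴴ[H_{μ,h},a]) ≥ 0, ω̃([H_{μ,h},b]) = 0 (charged words make μ enter affinely), optional density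
window; (2) CALIBRATION at U = 0 (sourced free gas, BdG blocks) and U < 0, and the card's fastest
refutation: floating point η_R at (8, 1.75, h = 0.01…0.05) vs (2, μ_free(7/8), h) — if η_R(8) is not
visibly below η_R(2) or stays ≥ 0.3 at the largest feasible R, report 'hierarchy does not resolve
the competition scale' (route kill (b)) with the convergence rate in R; (3) dual extraction,
rational rounding (slack into η via DWaveOnePointCertificat -/
@[route_item "route-HubbardSuperconductivity-AbsenceCertificate", crux]
def StripeOnePointCertificate : Prop :=
  ∃ (R : ℕ) (h₀ : ℝ), 0 < h₀ ∧ ∀ μ : ℝ, (∀ ε : ℝ, 0 < ε → ∃ L₀ : ℕ, ∀ L : ℕ, Even L → L₀ ≤ L → |(Literature.MathematicalPhysics.QuantumLattice.hubbardTorus 2 L 1 8).minEnergyOn (Literature.MathematicalPhysics.QuantumLattice.szSector (2 * ⌊(1 - 1 / 8) * (L : ℝ) ^ 2 / 2⌋₊) 0) - μ * ((2 * ⌊(1 - 1 / 8) * (L : ℝ) ^ 2 / 2⌋₊ : ℕ) : ℝ) - Matrix.groundEnergy (Literature.MathematicalPhysics.QuantumLattice.hubbardTorusWith 2 L 1 8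 μ)| ≤ ε * (L : ℝ) ^ 2) → ∀ h : ℝ, h ∈ Set.Ioo (0:ℝ) h₀ → Nonempty (Literature.MathematicalPhysics.QuantumLattice.DWaveOnePointCertificate R 8 μ h (1 / 20))

/-- item stmt-HubbardSuperconductivity-14356 · crux · rank 6 · open · by planner
why it might fail: Expected FALSE at weak coupling: Kohn–Luttinger/RG give a d_{x²−y²} ground state for 1>n>0.6 at t′=0 (RaghuKivelsonScalapino2010, arXiv p.7; DengEtAl2015 Fig.1) ⇒ m(U,μ)>0 at supporting μ for small U>0; Sorella2023 Fig.12 claims pure-model d-wave SC at U=8, δ≈0.19–0.25; no tool at U≈t.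
sources: RaghuKivelsonScalapino2010, DengEtAl2015, Sorella2023, ArovasBergKivelsonRaghu2022, QinEtAl2020, KomaTasaki1994
[crux] GLOBAL SOURCED VANISHING — the NAMED CONDITION the target UniversalSourcedVanishing is
conditional on (route-choice repair rev 8, needs_repair route.target-unreachable; option (a): glue
item + the condition filed as a crux): for every U > 0, every δ ∈ (0, 1/2) and EVERY μ that
canonically supports (U, δ) [clause (a) of the target: |minEnergyOn (szSector N_L 0) (hubbardTorus 2
L 1 U) − μN_L − groundEnergy (hubbardTorusWith 2 L 1 U μ)| ≤ εL² eventually along even L for every ε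
> 0, N_L = 2⌊(1−δ)L²/2⌋], the finite-volume Koma–Tasaki d-wave order parameter VANISHES in limsup
form [clause (b): ∀ η > 0 ∃ h₀ > 0 ∀ h ∈ (0, h₀) ∃ L₀ ∀ L ≥ L₀, dWaveSourceDensity L U μ h ≤ η,
m_L(h) = Re ω₀^{L,h}(P)/L² for the sourced grand-canonical torus Hamiltonian dWaveSourceTorus L U μ
h = H − μN − h(P + P†), P = pairField dWaveFormFactor L = √2·Δ_d] — in words: the pure
square-lattice repulsive Hubbard model (t = 1, t′ = 0) shows NO d_{x²−y²} symmetry breaking under an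
infinitesimal pair source at any hole doping in (0, 1/2). Same clause shapes as the target and as
StripeSourcedVanishing, which is literally its instance at (U, δ) = (8, 1/8) (planner's Sketch.lean
`stripeSourcedVanishing_of_global -/
@[route_item "route-HubbardSuperconductivity-AbsenceCertificate", crux]
def GlobalSourcedVanishing : Prop :=
  ∀ U : ℝ, 0 < U → ∀ δ : ℝ, δ ∈ Set.Ioo (0:ℝ) (1 / 2) → ∀ μ : ℝ, (∀ ε : ℝ, 0 < ε → ∃ L₀ : ℕ, ∀ L : ℕ, Even L → L₀ ≤ L → |(Literature.MathematicalPhysics.QuantumLattice.hubbardTorus 2 L 1 U).minEnergyOn (Literature.MathematicalPhysics.QuantumLattice.szSector (2 * ⌊(1 - δ) * (L : ℝ) ^ 2 / 2⌋₊) 0) - μ * ((2 * ⌊(1 - δ) * (L : ℝ) ^ 2 / 2⌋₊ : ℕ) : ℝ) - Matrix.groundEnergy (Literature.MathematicalPhysics.QuantumLattice.hubbardTorusWith 2 L 1 U μ)| ≤ ε * (L : ℝ) ^ 2) → ∀ η : ℝ, 0 < η → ∃ h₀ : ℝ, 0 < h₀ ∧ ∀ h : ℝ, h ∈ Set.Ioo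 (0:ℝ) h₀ → ∃ L₀ : ℕ, ∀ (L : ℕ) [NeZero L], L₀ ≤ L → Literature.MathematicalPhysics.QuantumLattice.dWaveSourceDensity L U μ h ≤ η

/-- item stmt-HubbardSuperconductivity-9486 · support · rank 2 · closed · proved by Summit.HubbardSuperconductivity.HubbardSuperconductivity.Theorems.AbsenceCertificate.sourcedOrderDominatesLRO_proof (prover) · by planner
why it might fail: As typed: bond pair densities overlap (KT hypothesis i) fails), so ‖[[O,H−μN],O]‖ ≤ C·L² and ‖[P,P†]‖ ≤ C·L² need a locality recount; the o(L²) ensemble clause and groundEnergy/minEnergyOn junk values at empty sectors must be fenced. On paper it is KHvdL 1989 / KT 1994 §3.4.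
sources: KaplanHorschVonDerLinden1989, Tasaki2019Tower, KomaTasaki1994, KomaTasaki1993, HorschVonDerLinden1988, Literature.Barriers.HubbardSuperconductivity.LROForcesLowLyingStates
[crux] (the engine; card P1/F1 in sourced finite-volume form) for all real U, μ, every N : ℕ → ℕ and
normalised (N_L, S^z=0)-sector ground states ψ_L of hubbardTorus 2 L 1 U (even L) whose sectors are
supported by μ [o(L²) grand-canonical excess as in the target]: if c·L⁴ ≤ Re⟨ψ_L, P†P ψ_L⟩ for all
even L ≥ L₀ (c > 0) then for every h > 0 and ε > 0, √(c/2) − ε ≤ dWaveSourceDensity L U μ h for all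
even L ≥ L₀′. Hence dWaveOrderParameter U μ ≥ √(c/2), and contrapositively any bound η on the
sourced order parameter is the every-ground-state ceiling LRO_P ≤ 2η². Proof sketch (one trial
state, no tower, no reflection positivity): O = P + P†, Ξ = (ψ + Oψ/‖Oψ‖)/√2 is a unit vector with
⟨Ξ,OΞ⟩ = ‖Oψ‖ = (2Re⟨P†P⟩ + ⟨[P,P†]⟩)^{1/2} ≥ (2cL⁴ − C₁L²)^{1/2} because ⟨O⟩ = ⟨O³⟩ = 0 in a
particle-number eigenstate; ⟨Ξ,(H − μN)Ξ⟩ − (E_sec − μN_L) = ⟨ψ,[[O, H − μN], O]ψ⟩/(4‖Oψ‖²) ≤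
C₂(U,μ)L²/(4(2cL⁴ − C₁L²)) (double commutator of finite-range sums); the variational principle
groundEnergy (dWaveSourceTorus L U μ h) ≤ ⟨Ξ,(H − μN − hO)Ξ⟩ and SourceSlopeBound give L²·m_L(h) ≥
⟨Ξ,OΞ⟩/2 − [C₂/(4cL²) + g_L(μ)]/(2h) with g_L(μ) = E_sec − μN_L − E₀^{gc}(μ) = o(L²). Ranked 2: the
hardest honest Lean work, unbl -/
@[route_item "route-HubbardSuperconductivity-AbsenceCertificate"]
def SourcedOrderDominatesLRO : Prop :=
  ∀ (U μ : ℝ) (N : ℕ → ℕ) (ψ : ∀ L, Literature.MathematicalPhysics.QuantumLattice.Fock (Literature.MathematicalPhysics.QuantumLattice.Orb (Literature.MathematicalPhysics.QuantumLattice.FermionTorus 2 L))), (∀ L, Even L → star (ψ L) ⬝ᵥ ψ L = 1 ∧ Literature.MathematicalPhysics.QuantumLattice.IsGroundStateInSector (Literature.MathematicalPhysics.QuantumLattice.hubbardTorus 2 L 1 U) (N L) 0 (ψ L)) → (∀ ε : ℝ, 0 < ε → ∃ L₀ : ℕ, ∀ L : ℕ, Even L → L₀ ≤ L → |(Literature.MathematicalPhysics.QuantumLattice.hubbardTorus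 2 L 1 U).minEnergyOn (Literature.MathematicalPhysics.QuantumLattice.szSector (N L) 0) - μ * (N L : ℝ) - Matrix.groundEnergy (Literature.MathematicalPhysics.QuantumLattice.hubbardTorusWith 2 L 1 U μ)| ≤ ε * (L : ℝ) ^ 2) → ∀ c : ℝ, 0 < c → (∃ L₀ : ℕ, ∀ (L : ℕ) [NeZero L], Even L → L₀ ≤ L → c * (L : ℝ) ^ 4 ≤ (Literature.MathematicalPhysics.QuantumLattice.expect (Matrix.conjTranspose (Literature.MathematicalPhysics.QuantumLattice.pairField Literature.MathematicalPhysics.QuantumLattice.dWaveFormFactor L) * Literature.MathematicalPhysics.QuantumLattice.pairField Literature.MathematicalPhysics.QuantumLattice.dWaveFormFactor L) (ψ L)).re) → ∀ h : ℝ, 0 < h → ∀ ε : ℝ, 0 < ε → ∃ L₀ : ℕ, ∀ (L : ℕ) [NeZero L], Even L → L₀ ≤ L → Real.sqrt (c / 2) - ε ≤ Literature.MathematicalPhysics.QuantumLattice.dWaveSourceDensity L U μ h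

-- earlier SourcedVanishingExcludesLRO (stmt-HubbardSuperconductivity-9489, replaced 2026-08-15T16:11:54Z -> stmt-HubbardSuperconductivity-10350): retired by None — ∀ U : ℝ, 0 < U → ∀ δ : ℝ, δ ∈ Set.Ioo (0:ℝ) (1 / 2) → (∃ μ : ℝ, (∀ ε : ℝ, 0 < ε → ∃ L₀ : ℕ, ∀ L : ℕ, Even L → L₀ ≤ L → |(Literature.MathematicalPhysics.QuantumLattice.hubbardTorus 2 L 1 U).minEnergyOn (Literature.MathematicalPhysics.Quant
/-- item stmt-HubbardSuperconductivity-10350 · support · rank 9 · closed · proved by Summit.HubbardSuperconductivity.HubbardSuperconductivity.Theorems.AbsenceCertificate.sourcedVanishingExcludesLRO_proof @ bfc2f28a25bc (prover) · by planner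
sources: KomaTasaki1994, KaplanHorschVonDerLinden1989, Scalapino1995, ArovasBergKivelsonRaghu2022
[support] (schema in the deciding chain) for every U > 0 and δ ∈ (0, 1/2): if some μ canonically
supports (U, δ) [clause (a) of the target: |minEnergyOn (szSector N_L 0) (hubbardTorus 2 L 1 U) −
μN_L − groundEnergy (hubbardTorusWith 2 L 1 U μ)| ≤ εL² eventually along even L, N_L = 2⌊(1−δ)L²/2⌋]
and the sourced d-wave order vanishes there [clause (b): ∀ η > 0 ∃ h₀ ∀ h ∈ (0, h₀) ∃ L₀ ∀ L ≥ L₀,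
dWaveSourceDensity L U μ h ≤ η], then the summit's matrix FAILS at (U, δ): NOT every admissible
(N_L, S^z = 0)-sector ground-state sequence ψ_L of hubbardTorus 2 L 1 U has d_{x²−y²} pair-field LRO
along even sides (HasLongRangeOrder of torusPullback (pairFieldCorr dWaveFormFactor ψ) (2k) over
halfOpenBox 2 (2k)). CONE REPAIR 2026-08-15: the conclusion is now the matrix of
Literature.Hubbard.DWaveSuperconductivityHubbard (= _root_.HubbardSuperconductivity after ∃ U > 0, ∃
δ ∈ Ioo 0 (1/2)) INLINED word for word — definitionally the former ¬HasDWavePairFieldLROAt U δ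
(Iff.rfl, checked in the planner's Sketch.lean) — so that the route file no longer imports
Literature.Barriers.HubbardSuperconductivity.PureModelStripeCompetition, whose two OPEN CONJECTURES
(PureModelStripeCompetition, PureModelStrip -/
@[route_item "route-HubbardSuperconductivity-AbsenceCertificate", crux]
def SourcedVanishingExcludesLRO : Prop :=
  ∀ U : ℝ, 0 < U → ∀ δ : ℝ, δ ∈ Set.Ioo (0:ℝ) (1 / 2) → (∃ μ : ℝ, (∀ ε : ℝ, 0 < ε → ∃ L₀ : ℕ, ∀ L : ℕ, Even L → L₀ ≤ L → |(Literature.MathematicalPhysics.QuantumLattice.hubbardTorus 2 L 1 U).minEnergyOn (Literature.MathematicalPhysics.QuantumLattice.szSector (2 * ⌊(1 - δ) * (L : ℝ) ^ 2 / 2⌋₊) 0) - μ * ((2 * ⌊(1 - δ) * (L : ℝ) ^ 2 / 2⌋₊ : ℕ) : ℝ) - Matrix.groundEnergy (Literature.MathematicalPhysics.QuantumLattice.hubbardTorusWith 2 L 1 U μ)| ≤ ε * (L : ℝ) ^ 2) ∧ (∀ η : ℝ, 0 < η → ∃ h₀ : ℝ, 0 < h₀ ∧ ∀ h : ℝ,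 h ∈ Set.Ioo (0:ℝ) h₀ → ∃ L₀ : ℕ, ∀ (L : ℕ) [NeZero L], L₀ ≤ L → Literature.MathematicalPhysics.QuantumLattice.dWaveSourceDensity L U μ h ≤ η)) → ¬ (∀ (N : ℕ → ℕ) (ψ : ∀ L, Literature.MathematicalPhysics.QuantumLattice.Fock (Literature.MathematicalPhysics.QuantumLattice.Orb (Literature.MathematicalPhysics.QuantumLattice.FermionTorus 2 L))), (∀ L, Even L → N L = 2 * ⌊(1 - δ) * (L : ℝ) ^ 2 / 2⌋₊ ∧ star (ψ L) ⬝ᵥ ψ L = 1 ∧ Literature.MathematicalPhysics.QuantumLattice.IsGroundStateInSector (Literature.MathematicalPhysics.QuantumLattice.hubbardTorus 2 L 1 U) (N L) 0 (ψ L)) → Literature.Probability.LatticeModels.HasLongRangeOrder (fun k => Literature.Probability.LatticeModels.halfOpenBox 2 (2 * k)) (fun k => Literature.MathematicalPhysics.QuantumLattice.torusPullback (Literature.MathematicalPhysics.QuantumLattice.pairFieldCorr Literature.MathematicalPhysics.QuantumLattice.dWaveFormFactor ψ) (2 * k)))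

-- earlier UniversalSourcedVanishingGlue (stmt-HubbardSuperconductivity-14357, replaced 2026-08-16T03:30:35Z -> stmt-HubbardSuperconductivity-14523): retired by None — CanonicalSupportingPotential → GlobalSourcedVanishing → UniversalSourcedVanishing
/-- item stmt-HubbardSuperconductivity-14523 · support · rank 9 · closed · proved by Summit.HubbardSuperconductivity.HubbardSuperconductivity.Theorems.AbsenceCertificate.universalSourcedVanishingGlue_proof (prover) · by planner
sources: KomaTasaki1994, Ruelle1969, Griffiths1966
[support] GLUE INTO THE TARGET (route-choice repair; needs_repair route.target-unreachable):
CanonicalSupportingPotential → GlobalSourcedVanishing → UniversalSourcedVanishing, with the first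
hypothesis = the statement of CanonicalSupportingPotential INLINED word for word (rev 9 restate: the
rev-8 rendering sorted this support item before `CanonicalSupportingPotential` and commented it out
as a forward reference — `example : UniversalSourcedVanishingGlue = (CanonicalSupportingPotential →
GlobalSourcedVanishing → UniversalSourcedVanishing) := rfl`, planner's Sketch3.lean). PROOF (pure
logic; Sketch3.lean `universalSourcedVanishingGlueR_proof`, lean check rc 0, 0 sorries): fix U > 0
and δ ∈ (0, 1/2) ⊂ (0, 1); the canonical-support hypothesis at (U, δ) gives μ with clause (a);
GlobalSourcedVanishing U δ μ (a) is the vanishing clause (b); conclude ⟨μ, (a), (b)⟩ — `intro hCSP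
hG U hU δ hδ; obtain ⟨μ, hμ⟩ := hCSP U δ ⟨hδ.1, hδ.2.trans (by norm_num)⟩; exact ⟨μ, hμ, hG U hU δ
hδ μ hμ⟩`. A prover lands it verbatim in Theorems/ with --workitem <this item> (do NOT import
Literature.Barriers.HubbardSuperconductivity.PureModelStripeCompetition, cf. the rev-3 cone repair).
With it the deciding ch -/
@[route_item "route-HubbardSuperconductivity-AbsenceCertificate"]
def UniversalSourcedVanishingGlue : Prop :=
  (∀ (U δ : ℝ), δ ∈ Set.Ioo (0:ℝ) 1 → ∃ μ : ℝ, ∀ ε : ℝ, 0 < ε → ∃ L₀ : ℕ, ∀ L : ℕ, Even L → L₀ ≤ L → |(Literature.MathematicalPhysics.QuantumLattice.hubbardTorus 2 L 1 U).minEnergyOn (Literature.MathematicalPhysics.QuantumLattice.szSector (2 * ⌊(1 - δ) * (L : ℝ) ^ 2 / 2⌋₊) 0) - μ * ((2 * ⌊(1 - δ) * (L : ℝ) ^ 2 / 2⌋₊ : ℕ) : ℝ) - Matrix.groundEnergy (Literature.MathematicalPhysics.QuantumLattice.hubbardTorusWith 2 L 1 U μ)| ≤ ε * (L : ℝ) ^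 2) → GlobalSourcedVanishing → UniversalSourcedVanishing

/-- item stmt-HubbardSuperconductivity-9490 · support · rank 9 · closed · proved by Summit.HubbardSuperconductivity.HubbardSuperconductivity.Theorems.AbsenceCertificate.sourceSlopeBound_proof (prover) · by planner
sources: KaplanHorschVonDerLinden1989, Griffiths1966, Kato1966, Tasaki2020
[support] for every L, U, μ and h > 0: (groundEnergy (dWaveSourceTorus L U μ 0) − groundEnergy
(dWaveSourceTorus L U μ h))/(2h) ≤ L²·dWaveSourceDensity L U μ h = Re ω₀^{L,h}(P). Proof: h ↦ E_L(h)
= λ_min(H_μ − hO) is concave (infimum of affine functions); its left derivative at h is −λ_min of O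
compressed to the ground space of H_μ − hO (first-order degenerate perturbation theory), which is ≤
the tracial average ω₀^{L,h}(O) = 2 Re ω₀^{L,h}(P); the supergradient inequality gives (E_L(0) −
E_L(h))/h ≤ −E_L′(h−). Abstract matrix lemma worth landing on its own: Hermitian A, O and h > 0 ⇒
(λ_min(A) − λ_min(A − hO))/h ≤ Re (Matrix.groundStateFunctional (A − hO) O). [difficulty:
provable-now] -/
@[route_item "route-HubbardSuperconductivity-AbsenceCertificate"]
def SourceSlopeBound : Prop :=
  ∀ (L : ℕ) [NeZero L] (U μ h : ℝ), 0 < h → (Matrix.groundEnergy (Literature.MathematicalPhysics.QuantumLattice.dWaveSourceTorus L U μ 0) - Matrix.groundEnergy (Literature.MathematicalPhysics.QuantumLattice.dWaveSourceTorus L U μ h)) / (2 * h) ≤ (L : ℝ) ^ 2 * Literature.MathematicalPhysics.QuantumLattice.dWaveSourceDensity L U μ h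

/-- item stmt-HubbardSuperconductivity-9491 · support · rank 9 · closed · proved by Summit.HubbardSuperconductivity.HubbardSuperconductivity.Theorems.canonicalSupportingPotential_proof @ 9513512d003a (prover) · by planner
sources: Ruelle1969, Simon1993, Griffiths1966, LiebWu1968
[support] (T = 0 equivalence of ensembles for the Hubbard torus) for every real U and δ ∈ (0,1)
there is μ such that |minEnergyOn (szSector N_L 0) (hubbardTorus 2 L 1 U) − μ·N_L − groundEnergy
(hubbardTorusWith 2 L 1 U μ)| ≤ εL² for all even L ≥ L₀(ε), N_L = 2⌊(1 − δ)L²/2⌋. Proof: existence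
of the ground-state energy density e(ρ) = lim E_L(N_L(ρ))/L² (block decomposition of the torus,
boundary hopping costs O(L), sector energies are C-Lipschitz in N), its convexity (two half-tori),
groundEnergy(H − μN)/L² → min_ρ (e(ρ) − μρ), and μ any subgradient of e at 1 − δ (all subgradients
lie in [−4, 4 + U⁺]). The S^z = 0 restriction is immaterial (N_L even ⇒ every spin multiplet of the
N_L-sector ground space has an S^z = 0 member). Library value beyond this route: the canonical ↔
grand-canonical dictionary every sourced-order-parameter route (WeakCouplingBCS, ChiralWindow,
AposterioriCapRg) silently needs. [difficulty: M] -/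
@[route_item "route-HubbardSuperconductivity-AbsenceCertificate"]
def CanonicalSupportingPotential : Prop :=
  ∀ (U δ : ℝ), δ ∈ Set.Ioo (0:ℝ) 1 → ∃ μ : ℝ, ∀ ε : ℝ, 0 < ε → ∃ L₀ : ℕ, ∀ L : ℕ, Even L → L₀ ≤ L → |(Literature.MathematicalPhysics.QuantumLattice.hubbardTorus 2 L 1 U).minEnergyOn (Literature.MathematicalPhysics.QuantumLattice.szSector (2 * ⌊(1 - δ) * (L : ℝ) ^ 2 / 2⌋₊) 0) - μ * ((2 * ⌊(1 - δ) * (L : ℝ) ^ 2 / 2⌋₊ : ℕ) : ℝ) - Matrix.groundEnergy (Literature.MathematicalPhysics.QuantumLattice.hubbardTorusWith 2 L 1 U μ)| ≤ ε * (L : ℝ) ^ 2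

/-- item stmt-HubbardSuperconductivity-9492 · support · rank 9 · open · by planner
sources: QinEtAl2020, XuEtAl2024, KomaTasaki1994
[support] (the quantitative every-ground-state corollary — the certifiable deliverable in the
summit's own units; target of the retired route) every admissible sequence at (U, δ) = (8, 1/8) —
N_L = 2⌊(7/8)L²/2⌋, ψ_L normalised (N_L, S^z=0)-sector ground states of hubbardTorus 2 L 1 8 at even
L — obeys: every eventual lower bound c·L⁴ ≤ Re⟨ψ_L, P†P ψ_L⟩ along even L has c ≤ 1/200, i.e.
liminf L⁻⁴⟨Δ_d†Δ_d⟩ ≤ 1/400 (P = √2Δ_d): any S-witness at the catalogued stripe point has Scalapino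
constant ≤ 1/400 (bond singlet amplitude ≤ 1/80 in Qin et al.'s normalisation, below the t′ = −0.2
model's 0.017(3)). PROVED in Sketch2.lean from SourcedOrderDominatesLRO +
CanonicalSupportingPotential + StripeSourceCeiling by pure logic (`stripePointCeiling_of`).
[difficulty: provable-now] -/
@[route_item "route-HubbardSuperconductivity-AbsenceCertificate"]
def StripePointCeiling : Prop :=
  ∀ (N : ℕ → ℕ) (ψ : ∀ L, Literature.MathematicalPhysics.QuantumLattice.Fock (Literature.MathematicalPhysics.QuantumLattice.Orb (Literature.MathematicalPhysics.QuantumLattice.FermionTorus 2 L))), (∀ L, Even L → N L = 2 * ⌊(1 - 1 / 8) * (L : ℝ) ^ 2 / 2⌋₊ ∧ star (ψ L) ⬝ᵥ ψ L = 1 ∧ Literature.MathematicalPhysics.QuantumLattice.IsGroundStateInSector (Literature.MathematicalPhysics.QuantumLattice.hubbardTorus 2 L 1 8) (N L) 0 (ψ L)) → ∀ c : ℝ, (∃ L₀ : ℕ, ∀ (L : ℕ) [NeZero L], Even L → L₀ ≤ L → c * (L : ℝ) ^ 4 ≤ (Literature.MathematicalPhysics.QuantumLattice.expect (Matrix.conjTranspose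 (Literature.MathematicalPhysics.QuantumLattice.pairField Literature.MathematicalPhysics.QuantumLattice.dWaveFormFactor L) * Literature.MathematicalPhysics.QuantumLattice.pairField Literature.MathematicalPhysics.QuantumLattice.dWaveFormFactor L) (ψ L)).re) → c ≤ 1 / 200

/-- item stmt-HubbardSuperconductivity-9685 · support · rank 9 · closed · proved by Summit.HubbardSuperconductivity.HubbardSuperconductivity.Theorems.AbsenceCertificate.onePointSoundness_proof (prover) · by planner
sources: AraujoEtAl2023, WangEtAl2024, Tasaki2020, Literature.MathematicalPhysics.QuantumLattice.DWaveOnePointCertificate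
[support] (layer 2 of StripeSourceCeiling) SOUNDNESS of one-point certificates: a
DWaveOnePointCertificate R U μ h η gives dWaveSourceDensity L U μ h ≤ η for all L ≥ L₀. Proof: apply
the tracial ground-state functional ω₀ = Matrix.groundStateFunctional (dWaveSourceTorus L U μ h) to
the certificate identity; ω₀(1) = 1; ω₀(sᴴs) ≥ 0 (groundProj is an orthogonal projection); ω₀(aᴴ(Ha
− aH)) = tr(P aᴴ(H − E₀)a)/tr P ≥ 0 since HP = PH = E₀P and H − E₀ ≥ 0; ω₀(Hb − bH) = 0 likewise;
ω₀(τ_x B − B) = 0 because translation of orbitals is an INNER automorphism of the full matrix (=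
CAR) algebra implemented by a unitary T_x with T_x (q.toMatrix L) T_x⁻¹ = (q.translate x).toMatrix
L, and T_x commutes with the translation-invariant H, hence with groundProj H; finally Re
ω₀(localPair 0) = Re ω₀(pairField)/L² = dWaveSourceDensity by the same invariance (localPair x = T_x
(localPair 0) T_x⁻¹). The implementing unitary (second-quantised site permutation with fermionic
signs) is the only non-trivial Lean ingredient. [deps: none] [difficulty: M] Sources: AraujoEtAl2023
§3.2/§6.1, WangEtAl2024, Tasaki2020 App. A, p43150 review note. -/
@[route_item "route-HubbardSuperconductivity-AbsenceCertificate"]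
def OnePointSoundness : Prop :=
  ∀ (R : ℕ) (U μ h η : ℝ), Nonempty (Literature.MathematicalPhysics.QuantumLattice.DWaveOnePointCertificate R U μ h η) → ∃ L₀ : ℕ, ∀ (L : ℕ) [NeZero L], L₀ ≤ L → Literature.MathematicalPhysics.QuantumLattice.dWaveSourceDensity L U μ h ≤ η

/-- item stmt-HubbardSuperconductivity-9493 · assembly · rank 1 · closed · proved by Summit.HubbardSuperconductivity.HubbardSuperconductivity.Theorems.absenceCertificate_assembly_proof (prover) · by planner
sources: KomaTasaki1994, KaplanHorschVonDerLinden1989, QinEtAl2020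
[assembly] SourcedVanishingExcludesLRO → UniversalSourcedVanishing → ¬HubbardSuperconductivity. -/
@[route_item "route-HubbardSuperconductivity-AbsenceCertificate"]
def Assembly : Prop :=
  SourcedVanishingExcludesLRO → UniversalSourcedVanishing → ¬ HubbardSuperconductivity

/-! D-0027 §2.1 — DECIDING THEOREM (planner-authored via `route open/edit --closes-file`; by planner-rbadge-HubbardSuperconductivity-Absenc-3b8517f1-0 2026-08-15T20:34:46Z):
its hypotheses are this route's items and its conclusion the sub-problem Statement (glue_lint), and it elaborates with this file. -/

@[closes "route-HubbardSuperconductivity-AbsenceCertificate"] theorem closes (hSchema : SourcedVanishingExcludesLRO) (hX : UniversalSourcedVanishing) :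
    ¬ _root_.HubbardSuperconductivity := by
  intro hS
  obtain ⟨U, hU, δ, hδ, hall⟩ := (_root_.HubbardSuperconductivity_iff).1 hS
  exact hSchema U hU δ hδ (hX U hU δ hδ) hall

end Summit.HubbardSuperconductivity.HubbardSuperconductivity.Theses.AbsenceCertificate
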